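import Literature.AnabelianGeometry.AbsoluteAnabelian.FreeProSigmaTorsionFree
import Literature.AnabelianGeometry.SemiGraphs.ProSigmaSurfaceCharacters
import Literature.GroupTheory.CombinatorialGroupTheory.SurfaceGroupFiniteIndexSubgroupHolds
import HarnessLib

/-!
# Pro-`Σ` completions of closed surface groups `S_g` (`g ≥ 2`) are TORSION-FREE; the general
# "cyclic quotients lift through `ℤ`" criterion

S. Mochizuki, *Topics in Absolute Anabelian Geometry I: Generalities* (2012) [AbsTopI] (lit key
`paper:url-11ac98ba15fc`), Lemma 4.5 (i)/(iii)/(iv) p. 54 ("torsion-free pro-`Σ` [characteristic] open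
subgroup `H ⊆ Δ`"); [SemiAnbd] Example 2.10 p. 31 (vertex groups = pro-`Σ` completions of `Γ_{g,r}`).  At the
PROPER models (`r = 0`: `Δ` a pro-`Σ` completion of `S_g`, `g ≥ 2`) exhibiting such `H` needs: **pro-`Σ`
completions of closed surface groups are torsion-free**.  The tree has the case `Σ = Primes` for Mathlib's
`ProfiniteCompletion` (`Literature/IUT/HodgeTheaters/SurfaceGroupCompletionTorsionFree.lean`, [IUTchI] Lem
2.7 (vi) route); this PROOF-ONLY file (no definitions, no named facts) proves it for the L3 interface
`IsProSigmaCompletion Σ ι`, ANY `Σ`, by abstracting the free-group argument of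
`FreeProSigmaTorsionFree.lean` (abc-iut-L4-t15) into a criterion:

* `IsProSigmaCompletion.eq_one_of_pow_eq_one_of_liftsThroughInt` — if EVERY finite-index subgroup `H ⊆ Γ`
  has the property "a homomorphism `H → Q` with image in a cyclic subgroup `⟨a⟩` is `h ↦ a ^ σ(h)` for some
  `σ : H → ℤ`" (true for free groups by Nielsen–Schreier, for `S_g` by F_cov + the one-relator
  presentation), then every pro-`Σ` completion `P` of `Γ` (`P` profinite) is torsion-free;
* `IsProSigmaCompletion.eq_one_of_pow_eq_one_surfaceGroup` — **`Γ ≅ S_g`, `g ≥ 2`, `ι : Γ → P` a pro-`Σ`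
  completion, `z ^ m = 1`, `m > 0` ⇒ `z = 1`** (F_cov = the tree's THEOREM
  `surfaceGroupFiniteIndexSubgroup_holds`: a finite-index subgroup of `S_g` is an `S_h`; the lift through
  `ℤ` on `S_h`: exponents on the generators, the relator `∏[aᵢ,bᵢ]` dies in `ℤ`);
  `…isOfFinOrder_iff_surfaceGroup`; the `PuncturedSurfaceGroup g 0` forms.

PROOF of the criterion (componentwise; no cohomological dimension): reduce to a prime exponent `q`;
`q ∉ Σ` is `eq_one_of_pow_eq_one_of_not_mem` (any `Γ`); for `q ∈ Σ` and an open normal `U₀`: `a := z U₀` of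
order `c ∣ [P : U₀]`, `H̄ ⊇ U₀` the open preimage of `⟨a⟩`, `H := ι⁻¹H̄` of finite index, `θ : H → ⟨a⟩`
lifted to `σ : H → ℤ` (HYPOTHESIS), `K := Ker(H → ℤ/qc)` the pull-back of an open `K̄ ⊆ H̄` (`comap_surj` of
abc-iut-L5-t9's `restrict`), an open normal `N ⊆ U₀ ∩ K̄`, `f ∈ H` with `z ∈ ι(f) N` (`exists_mem_coset`):
`ι(f)^q ∈ N` gives `c ∣ σ(f)` and `a = θ(f) = 1`.

HONEST FRAMING: classical profinite group theory; refereed, undisputed; nothing here bears on [IUTchIII]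
Cor. 3.12; typed ≠ proved elsewhere.
-/

noncomputable section

open Topology

universe u v w

namespace Literature.AnabelianGeometry.SemiGraphs.SemiGraphOfAnabelioids.IsProSigmaCompletion

open Literature.AnabelianGeometry.Anabelioids (IsSigmaInteger)
open Literature.GroupTheory.CombinatorialGroupTheory
open Literature.Topology.FourManifolds (SurfaceGroup surfaceGen surfaceRelator genA genB)

variable {Sigma : Set ℕ} {Γ : Type v} [Group Γ] {P : Type u} [Group P] [TopologicalSpace P]
  {ι : Γ →* P}

/-! ### The criterion: finite-index subgroups whose cyclic quotients lift through `ℤ` -/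

omit [TopologicalSpace P] [Group Γ] in
/-- A prime in `Σ` is a `Σ`-integer. [cite: MochizukiSemiAnbd2006, Def. 2.9(i) p.31] -/
private theorem isSigmaInteger_of_prime_mem' {q : ℕ} (hq : q.Prime) (hqS : q ∈ Sigma) :
    IsSigmaInteger Sigma q := by
  refine ⟨hq.pos, fun p hp hpq => ?_⟩
  obtain rfl : p = q := (Nat.prime_dvd_prime_iff_eq hp hq).mp hpq
  exact hqS

omit [Group Γ] in
/-- In a profinite group an element lying in every open normal subgroup is trivial. [folklore] -/
private theorem eq_one_of_forall_mem_openNormal' [IsTopologicalGroup P] [CompactSpace P] [T2Space P]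
    [TotallyDisconnectedSpace P] {z : P} (h : ∀ N : OpenNormalSubgroup P, z ∈ (N : Subgroup P)) :
    z = 1 := by
  by_contra hz
  obtain ⟨N, hN⟩ := ProfiniteGrp.exist_openNormalSubgroup_sub_open_nhds_of_one
    (isOpen_compl_singleton (x := z)) (show (1 : P) ∈ ({z}ᶜ : Set P) from fun h1 => hz h1.symm)
  exact hN (h N) rfl

/-- The core step of the criterion at a prime `q ∈ Σ` and an open normal `U₀`: if every finite-index
subgroup of `Γ` lifts its cyclic quotients through `ℤ`, then `z ^ q = 1` forces `z ∈ U₀`.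
[cite: MochizukiAbsTopI2012, Lemma 4.5 (i) p.54] -/
theorem mem_of_pow_eq_one_of_liftsThroughInt [IsTopologicalGroup P] [CompactSpace P]
    [TotallyDisconnectedSpace P] (hι : IsProSigmaCompletion Sigma ι)
    (hlift : ∀ (H : Subgroup Γ), H.FiniteIndex → ∀ (Q : Type u) [Group Q] (θ : H →* Q) (a : Q),
      (∀ h, θ h ∈ Subgroup.zpowers a) →
        ∃ σ : H →* Multiplicative ℤ, ∀ h, θ h = a ^ Multiplicative.toAdd (σ h))
    {q : ℕ} (hq : q.Prime) (hqS : q ∈ Sigma) {z : P} (hz : z ^ q = 1) (U₀ : OpenNormalSubgroup P) :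
    z ∈ (U₀ : Subgroup P) := by
  classical
  set U : Subgroup P := (U₀ : Subgroup P) with hUdef
  haveI hUn : U.Normal := U₀.isNormal'
  have hUo : IsOpen (U : Set P) := U₀.isOpen'
  haveI : Finite (P ⧸ U) := Subgroup.quotient_finite_of_isOpen U hUo
  haveI : DiscreteTopology (P ⧸ U) := QuotientGroup.discreteTopology hUo
  -- `a := z U₀`, of order `c ∣ [P : U₀]`, a `Σ`-integer
  set a : P ⧸ U := QuotientGroup.mk z with hadef
  rw [← QuotientGroup.eq_one_iff]
  change a = 1
  set c : ℕ := orderOf a with hcdef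
  have hcS : IsSigmaInteger Sigma c := (hι.index_open U hUn hUo).of_dvd (orderOf_dvd_natCard a)
  have hqcS : IsSigmaInteger Sigma (q * c) := (isSigmaInteger_of_prime_mem' hq hqS).mul hcS
  -- `H̄ :=` preimage of `⟨a⟩`: open, `⊇ U`, `∋ z`
  set Hbar : Subgroup P := (Subgroup.zpowers a).comap (QuotientGroup.mk' U) with hHbar
  have hUH : U ≤ Hbar := fun u hu => by
    change (QuotientGroup.mk' U) u ∈ Subgroup.zpowers a
    rw [QuotientGroup.mk'_apply, (QuotientGroup.eq_one_iff u).mpr hu]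
    exact one_mem _
  have hHo : IsOpen (Hbar : Set P) := by
    change IsOpen ((QuotientGroup.mk' U) ⁻¹' (Subgroup.zpowers a : Set (P ⧸ U)))
    exact (isOpen_discrete _).preimage QuotientGroup.continuous_mk
  have hzH : z ∈ Hbar := Subgroup.mem_zpowers a
  -- `H := ι⁻¹ H̄` has finite index; `ι| : H → H̄` is a pro-`Σ` completion
  haveI : CompactSpace Hbar := isCompact_iff_compactSpace.mp (Hbar.isClosed_of_isOpen hHo).isCompact
  have hres : IsProSigmaCompletion Sigma (ι.subgroupComap Hbar) := hι.restrict Hbar hHo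
  have hHfi : (Hbar.comap ι).FiniteIndex := hι.finiteIndex_comap Hbar hHo
  -- `θ : H → ⟨a⟩` lifts through `ℤ` (hypothesis)
  let θ : Hbar.comap ι →* P ⧸ U := (QuotientGroup.mk' U).comp (ι.comp (Hbar.comap ι).subtype)
  have hθapp : ∀ h : Hbar.comap ι, θ h = QuotientGroup.mk (ι h) := fun _ => rfl
  have hθ : ∀ h : Hbar.comap ι, θ h ∈ Subgroup.zpowers a := fun h => h.2
  obtain ⟨σ, hσ⟩ := hlift (Hbar.comap ι) hHfi (P ⧸ U) θ a hθ
  -- `K := Ker(H → ℤ → ℤ/qc)`, normal of `Σ`-integer index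
  haveI : NeZero (q * c) := ⟨(Nat.mul_pos hq.pos (orderOf_pos a)).ne'⟩
  let π : Multiplicative ℤ →* Multiplicative (ZMod (q * c)) :=
    (Int.castAddHom (ZMod (q * c))).toMultiplicative
  have hπ : ∀ t : Multiplicative ℤ,
      π t = Multiplicative.ofAdd ((Multiplicative.toAdd t : ℤ) : ZMod (q * c)) := fun _ => rfl
  let K : Subgroup (Hbar.comap ι) := (π.comp σ).ker
  haveI hKn : K.Normal := MonoidHom.normal_ker _
  have hKS : IsSigmaInteger Sigma K.index := by
    refine hqcS.of_dvd ?_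
    have h1 : K.index = Nat.card (π.comp σ).range := Subgroup.index_ker _
    have h2 : Nat.card (π.comp σ).range ∣ Nat.card (Multiplicative (ZMod (q * c))) :=
      Subgroup.card_subgroup_dvd_card _
    rw [h1]
    simpa [Nat.card_eq_fintype_card, ZMod.card] using h2
  -- `K` is the pull-back of an open `K̄' ⊆ H̄`
  obtain ⟨K', hK'o, hK'⟩ := hres.comap_surj K hKn hKS
  have hKbo : IsOpen ((K'.map Hbar.subtype : Subgroup P) : Set P) :=
    isOpen_map_subtype Hbar hHo K' hK'o
  -- `N ⊴ P` open normal inside `U ∩ K̄`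
  obtain ⟨N, hN⟩ := ProfiniteGrp.exist_openNormalSubgroup_sub_open_nhds_of_one (hUo.inter hKbo)
    ⟨U.one_mem, (K'.map Hbar.subtype).one_mem⟩
  haveI : (N : Subgroup P).Normal := N.isNormal'
  -- `f ∈ Γ` with `z⁻¹ ι(f) ∈ N`; then `f ∈ H` and `θ f = a`
  obtain ⟨f, hf⟩ := hι.exists_mem_coset (N : Subgroup P) N.isOpen' z
  have hfU : z⁻¹ * ι f ∈ U := (hN hf).1
  have hfH : f ∈ Hbar.comap ι := by
    change ι f ∈ Hbar
    have : ι f = z * (z⁻¹ * ι f) := by group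
    rw [this]
    exact Hbar.mul_mem hzH (hUH hfU)
  have hθf : θ ⟨f, hfH⟩ = a := by
    rw [hθapp, hadef, eq_comm, QuotientGroup.eq]
    exact hfU
  -- `ι(f)^q ∈ N ⊆ K̄`, hence `f^q ∈ K`
  have hfqN : ι (f ^ q) ∈ (N : Subgroup P) := by
    rw [← QuotientGroup.eq_one_iff]
    have h1 : (QuotientGroup.mk (ι f) : P ⧸ (N : Subgroup P)) = QuotientGroup.mk z := by
      rw [eq_comm, QuotientGroup.eq]; exact hf
    rw [map_pow, QuotientGroup.mk_pow, h1, ← QuotientGroup.mk_pow, hz, QuotientGroup.mk_one]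
  have hfqK : (⟨f, hfH⟩ : Hbar.comap ι) ^ q ∈ K := by
    rw [← hK', Subgroup.mem_comap]
    obtain ⟨k', hk'K, hk'⟩ := Subgroup.mem_map.mp (hN hfqN).2
    have hk'eq : k' = (ι.subgroupComap Hbar) ((⟨f, hfH⟩ : Hbar.comap ι) ^ q) := by
      apply Subtype.ext
      rw [map_pow]
      change (k' : P) = ((ι.subgroupComap Hbar ⟨f, hfH⟩ : Hbar) : P) ^ q
      rw [MonoidHom.subgroupComap_apply_coe]
      change (Hbar.subtype k') = ι f ^ q
      rw [hk', map_pow]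
    rw [← hk'eq]
    exact hk'K
  -- so `qc ∣ q·σ(f)`, `c ∣ σ(f)`, and `a = θ f = a^{σ f} = 1`
  set s : ℤ := Multiplicative.toAdd (σ ⟨f, hfH⟩) with hsdef
  have hdvd : ((q * c : ℕ) : ℤ) ∣ (q : ℤ) * s := by
    have h1 : π (σ ((⟨f, hfH⟩ : Hbar.comap ι) ^ q)) = 1 := hfqK
    rw [map_pow, hπ, toAdd_pow, ← hsdef] at h1
    have h2 : (((q • s : ℤ) : ZMod (q * c))) = 0 := by
      have := congrArg Multiplicative.toAdd h1
      rwa [toAdd_ofAdd, toAdd_one] at this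
    rw [ZMod.intCast_zmod_eq_zero_iff_dvd] at h2
    simpa [nsmul_eq_mul] using h2
  have hcs : (c : ℤ) ∣ s := by
    have hq0 : (q : ℤ) ≠ 0 := by exact_mod_cast hq.ne_zero
    rw [Nat.cast_mul] at hdvd
    exact (mul_dvd_mul_iff_left hq0).mp hdvd
  have has : a ^ s = 1 := orderOf_dvd_iff_zpow_eq_one.mp (by rw [← hcdef]; exact hcs)
  rw [← hθf, hσ, ← hsdef, has]

/-- **Torsion-freeness criterion for pro-`Σ` completions.**  Let `ι : Γ → P` be a pro-`Σ` completion with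
`P` profinite, and suppose every finite-index subgroup `H ⊆ Γ` lifts its cyclic quotients through `ℤ`
(homomorphisms `H → Q` with image in some `⟨a⟩` are of the form `h ↦ a ^ σ(h)`, `σ : H → ℤ`).  Then `P`
is TORSION-FREE: `z ^ m = 1`, `m > 0` ⇒ `z = 1`. [cite: MochizukiAbsTopI2012, Lemma 4.5 (i) p.54] -/
theorem eq_one_of_pow_eq_one_of_liftsThroughInt [IsTopologicalGroup P] [CompactSpace P] [T2Space P]
    [TotallyDisconnectedSpace P] (hι : IsProSigmaCompletion Sigma ι)
    (hlift : ∀ (H : Subgroup Γ), H.FiniteIndex → ∀ (Q : Type u) [Group Q] (θ : H →* Q) (a : Q),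
      (∀ h, θ h ∈ Subgroup.zpowers a) →
        ∃ σ : H →* Multiplicative ℤ, ∀ h, θ h = a ^ Multiplicative.toAdd (σ h))
    {z : P} {m : ℕ} (hm : 0 < m) (hz : z ^ m = 1) : z = 1 := by
  induction m using Nat.strong_induction_on generalizing z with
  | _ m ih =>
    rcases Nat.lt_or_ge 1 m with h1 | h1
    · obtain ⟨q, hq, hqm⟩ := Nat.exists_prime_and_dvd h1.ne'
      obtain ⟨k, rfl⟩ := hqm
      have hk : 0 < k := Nat.pos_of_mul_pos_left hm
      have hzk : (z ^ k) ^ q = 1 := by rw [← pow_mul, mul_comm]; exact hz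
      have hzk1 : z ^ k = 1 := by
        by_cases hqS : q ∈ Sigma
        · exact eq_one_of_forall_mem_openNormal' fun N =>
            mem_of_pow_eq_one_of_liftsThroughInt hι hlift hq hqS hzk N
        · exact eq_one_of_pow_eq_one_of_not_mem hι hq hqS hzk
      have hkm : k < q * k := by
        have := hq.two_le
        nlinarith
      exact ih k hkm hk hzk1
    · have hm1 : m = 1 := le_antisymm h1 hm
      subst hm1
      rwa [pow_one] at hz

/-! ### Surface groups lift their cyclic quotients through `ℤ` (F_cov + the one-relator presentation) -/

omit [TopologicalSpace P] [Group Γ] in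
/-- The surface relator `∏_{i<g} [aᵢ, bᵢ]` dies under every homomorphism to a commutative group.
[folklore] -/
private theorem surfaceRelator_lift_eq_one_of_comm {A : Type w} [CommGroup A] (g : ℕ)
    (f : surfaceGen g → A) : FreeGroup.lift f (surfaceRelator g) = 1 := by
  rw [surfaceRelator, map_list_prod, List.map_map]
  apply List.prod_eq_one
  intro x hx
  rw [List.mem_map] at hx
  obtain ⟨i, -, rfl⟩ := hx
  simp only [Function.comp_apply, map_mul, map_inv, genA, genB, FreeGroup.lift_apply_of]
  rw [mul_inv_eq_one, mul_inv_eq_iff_eq_mul, mul_comm]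

omit [TopologicalSpace P] [Group Γ] in
/-- A homomorphism from `S_g = ⟨aᵢ, bᵢ ∣ ∏ [aᵢ, bᵢ]⟩` with image in a cyclic subgroup `⟨a⟩` lifts through
`ℤ`: `θ(h) = a ^ σ(h)` (exponents on the generators; the relator maps to `0 ∈ ℤ`). [folklore] -/
private theorem surfaceGroup_exists_hom_int_zpow {Q : Type w} [Group Q] (g : ℕ)
    (θ : SurfaceGroup g →* Q) (a : Q) (hθ : ∀ h, θ h ∈ Subgroup.zpowers a) :
    ∃ σ : SurfaceGroup g →* Multiplicative ℤ, ∀ h, θ h = a ^ Multiplicative.toAdd (σ h) := by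
  classical
  have hk : ∀ s : surfaceGen g, ∃ k : ℤ, a ^ k = θ (PresentedGroup.of s) := fun s =>
    Subgroup.mem_zpowers_iff.mp (hθ _)
  choose k hk using hk
  let f : surfaceGen g → Multiplicative ℤ := fun s => Multiplicative.ofAdd (k s)
  have hf : ∀ r ∈ ({surfaceRelator g} : Set (FreeGroup (surfaceGen g))), FreeGroup.lift f r = 1 := by
    intro r hr
    rw [Set.mem_singleton_iff] at hr
    subst hr
    exact surfaceRelator_lift_eq_one_of_comm g f
  refine ⟨PresentedGroup.toGroup hf, fun h => ?_⟩
  have key : θ = (zpowersHom Q a).comp (PresentedGroup.toGroup hf) := by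
    refine PresentedGroup.ext fun s => ?_
    rw [MonoidHom.comp_apply, PresentedGroup.toGroup.of, zpowersHom_apply, toAdd_ofAdd, hk s]
  conv_lhs => rw [key]
  rfl

omit [TopologicalSpace P] in
/-- **Finite-index subgroups of a closed surface group `Γ ≅ S_g` (`g ≥ 2`) lift their cyclic quotients
through `ℤ`** — F_cov (`surfaceGroupFiniteIndexSubgroup_holds`: a finite-index subgroup of `S_g` is an
`S_h`) and the lifting on `S_h`. [cite: MochizukiAbsTopI2012, Lemma 4.5 (i) p.54] -/
theorem liftsThroughInt_of_surfaceGroup {g : ℕ} (hg : 2 ≤ g) (e : Γ ≃* SurfaceGroup g)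
    (H : Subgroup Γ) (hH : H.FiniteIndex) (Q : Type w) [Group Q] (θ : H →* Q) (a : Q)
    (hθ : ∀ h, θ h ∈ Subgroup.zpowers a) :
    ∃ σ : H →* Multiplicative ℤ, ∀ h, θ h = a ^ Multiplicative.toAdd (σ h) := by
  classical
  haveI := hH
  -- `H ≅ e(H) ≅ S_h` by F_cov
  let K : Subgroup (SurfaceGroup g) := H.map (e : Γ →* SurfaceGroup g)
  have hKidx : K.index = H.index := Subgroup.index_map_equiv _ e
  haveI hKfi : K.FiniteIndex := ⟨by rw [hKidx]; exact hH.index_ne_zero⟩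
  obtain ⟨h, -, ⟨e₂⟩⟩ := surfaceGroupFiniteIndexSubgroup_holds g hg K hKfi
  let eH : H ≃* SurfaceGroup h := (e.subgroupMap H).trans e₂
  obtain ⟨σ₀, hσ₀⟩ :=
    surfaceGroup_exists_hom_int_zpow h (θ.comp eH.symm.toMonoidHom) a fun x => hθ _
  refine ⟨σ₀.comp eH.toMonoidHom, fun x => ?_⟩
  have := hσ₀ (eH x)
  rw [MonoidHom.comp_apply, MulEquiv.coe_toMonoidHom, MulEquiv.symm_apply_apply] at this
  rw [this]
  rfl

/-! ### Pro-`Σ` completions of closed surface groups are torsion-free -/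

/-- **Pro-`Σ` completions of closed surface groups are torsion-free**: for `Γ ≅ S_g` (`g ≥ 2`),
`ι : Γ → P` a pro-`Σ` completion with `P` profinite (any `Σ`), and `z ^ m = 1` with `m > 0`, one has
`z = 1`. [cite: MochizukiAbsTopI2012, Lemma 4.5 (i) p.54] -/
theorem eq_one_of_pow_eq_one_surfaceGroup [IsTopologicalGroup P] [CompactSpace P] [T2Space P]
    [TotallyDisconnectedSpace P] (hι : IsProSigmaCompletion Sigma ι) {g : ℕ} (hg : 2 ≤ g)
    (e : Γ ≃* SurfaceGroup g) {z : P} {m : ℕ} (hm : 0 < m) (hz : z ^ m = 1) : z = 1 :=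
  eq_one_of_pow_eq_one_of_liftsThroughInt hι
    (fun H hH Q _ θ a hθ => liftsThroughInt_of_surfaceGroup hg e H hH Q θ a hθ) hm hz

/-- In a pro-`Σ` completion of a closed surface group of genus `≥ 2` (profinite), an element has finite
order iff it is trivial. [cite: MochizukiAbsTopI2012, Lemma 4.5 (i) p.54] -/
theorem isOfFinOrder_iff_surfaceGroup [IsTopologicalGroup P] [CompactSpace P] [T2Space P]
    [TotallyDisconnectedSpace P] (hι : IsProSigmaCompletion Sigma ι) {g : ℕ} (hg : 2 ≤ g)
    (e : Γ ≃* SurfaceGroup g) {z : P} : IsOfFinOrder z ↔ z = 1 := by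
  refine ⟨fun h => ?_, fun h => h ▸ IsOfFinOrder.one⟩
  obtain ⟨m, hm, hzm⟩ := h.exists_pow_eq_one
  exact eq_one_of_pow_eq_one_surfaceGroup hι hg e hm hzm

omit [Group Γ] in
/-- **The proper models of [SemiAnbd] Ex. 2.10 / [AbsTopI] §2: pro-`Σ` completions of `Γ_{g,0}`, `g ≥ 2`,
are torsion-free** (`Γ_{g,0} ≅ S_g`, `nonempty_mulEquiv_puncturedSurfaceGroup_zero`).
[cite: MochizukiSemiAnbd2006, Ex. 2.10 p.31] -/
theorem eq_one_of_pow_eq_one_closedSurfaceGroup [IsTopologicalGroup P] [CompactSpace P] [T2Space P]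
    [TotallyDisconnectedSpace P] {g : ℕ} (hg : 2 ≤ g) {ι : PuncturedSurfaceGroup g 0 →* P}
    (hι : IsProSigmaCompletion Sigma ι) {z : P} {m : ℕ} (hm : 0 < m) (hz : z ^ m = 1) : z = 1 := by
  obtain ⟨e⟩ := nonempty_mulEquiv_puncturedSurfaceGroup_zero g
  exact eq_one_of_pow_eq_one_surfaceGroup hι hg e hm hz

omit [Group Γ] in
/-- **Every pro-`Σ` completion of a hyperbolic `Γ_{g,r}` with `r ≥ 1` or `g ≥ 2` is torsion-free** — both
classes of models at once (affine: `eq_one_of_pow_eq_one_puncturedSurfaceGroup` of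
`FreeProSigmaTorsionFree.lean`; proper: `eq_one_of_pow_eq_one_closedSurfaceGroup`), in the
`IsOfFinOrder` shape of [AbsTopI] Lem 4.5's "torsion-free pro-`Σ` open subgroup".
[cite: MochizukiAbsTopI2012, Lemma 4.5 (i) p.54] -/
theorem torsionFree_puncturedSurfaceGroup [IsTopologicalGroup P] [CompactSpace P] [T2Space P]
    [TotallyDisconnectedSpace P] {g r : ℕ} (hgr : 1 ≤ r ∨ 2 ≤ g) {ι : PuncturedSurfaceGroup g r →* P}
    (hι : IsProSigmaCompletion Sigma ι) : ∀ z : P, IsOfFinOrder z → z = 1 := by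
  intro z hzfin
  obtain ⟨m, hm, hzm⟩ := hzfin.exists_pow_eq_one
  rcases Nat.eq_zero_or_pos r with hr | hr
  · subst hr
    have hg : 2 ≤ g := hgr.resolve_left (by omega)
    exact eq_one_of_pow_eq_one_closedSurfaceGroup hg hι hm hzm
  · exact eq_one_of_pow_eq_one_puncturedSurfaceGroup hr hι hm hzm

end Literature.AnabelianGeometry.SemiGraphs.SemiGraphOfAnabelioids.IsProSigmaCompletion

end
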